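import Literature.Algebra.Homology.OrderedCechSystemAugment
import Literature.Algebra.Homology.OrderedCechContraction
import HarnessLib

/-!
# The ordered Čech complex of a system with an APEX VERTEX is contractible (Stacks 0G6T / 01FG, system dialect)

Layer `Literature/Algebra/Homology` (proved lemmas only; 0 `def`, 0 named facts, no instance, no notation; pure homological
algebra over a commutative ring `A`).  `Algebra/Homology/OrderedCechContraction` proves that the ordered Čech complex of a
monotone family of SUBmodules `F s ⊆ 𝕂` with a member containing everything (`F (s ∪ {i}) ≤ F s`) is exact (the cone
contraction `(h c)_τ = ε(τ ∪ i, i) c_{τ ∪ i}`, Stacks Project Tag 0G6T: «if `U_i = U` for some `i` the extended ordered Čech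
complex `𝓕(U) → Č•_ord(𝓤, 𝓕)` is homotopy equivalent to zero»).  This file is the same statement for the ordered Čech complex
`Č•(N) = sysComplex N` of a SYSTEM `N : Finset κ ⥤ ModuleCat A` (`Algebra/Homology/OrderedCechSystem`: restriction MAPS instead
of inclusions, e.g. `t ↦ Γ(W_t, 𝓛)` on a non-integral scheme), where «`W_j` contains everything» reads: **every restriction
`N t → N (t ∪ {j})` is bijective** (an APEX VERTEX `j`).  Conclusion, in the three elementwise shapes consumed by the
comparison theorems of `Algebra/Homology/OrderedCechPairSystemComparison` / `…ColumnCriterion` / `…SystemAugmentExact`: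

* `sysAugment_injective_of_apex` — the augmentation `ε : N ∅ → Č⁰(N)` is injective;
* `exists_sysAugment_eq_of_apex` — every `0`-cocycle is an augmented value;
* `exists_sysD_eq_of_apex`, `exists_d_eq_of_apex` — `Č•(N)` is exact in every degree `≥ 1`;

all from the homotopy identity `sysD_cone_add_cone_sysD` (`d h + h d = id` in degrees `≥ 1` for the cone
`(h c)_τ = ε(τ ∪ j, j) · r_τ (c_{τ ∪ j})`, `r_τ` the inverse of `N τ → N (τ ∪ j)`; the sign identity is
`OrderedCech.sign_cone_add`), stated with the cone written out (no auxiliary definition) and with the inverses `r_t` as a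
hypothesis family, then discharged from bijectivity.  Also the small tool `bijective_map_of_eq`: a system maps a morphism
between EQUAL index sets to a bijection — the form in which apex vertices arise for the shifted systems
`T ↦ P (s ∪ π₁T) (t ∪ π₂T)` of a pair-system (sequel `Algebra/Homology/OrderedCechPairSystemLexComparison`, the comparison of
the total Čech complex of a pair-system with the Čech complex of the product cover).  Library only (cell `hodgecm-mathlib`,
F-11/J3 Künneth packet (S1′), count-neutral); proves nothing about any crux, route or conjecture.  Mathlib searched (pin v4.32):
`LinearEquiv.ofBijective`, `Finset.insert_erase`, `Finset.erase_insert_of_ne`, `Finset.sum_insert`, `homOfLE`,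
`Subsingleton.elim` on morphisms of a preorder category (used); Mathlib has no ordered Čech complex of a system of modules.

## References

* The Stacks Project, Tag 0G6T (contractible ordered Čech complex when `U_i = U`), Tag 01FG (ordered Čech complex),
  Tag 01X9 (the same homotopy). [StacksProject]
* U. Görtz, T. Wedhorn, *Algebraic Geometry II* (2023), Lemma 21.65, Def. 21.68, Prop. 21.69 (pp. 179–181). [GortzWedhorn2023]
-/

noncomputable section

universe u v

open CategoryTheory Finset

namespace Literature.Algebra.Homology

namespace OrderedCech

variable {κ : Type} [LinearOrder κ] {A : Type u} [CommRing A]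

/-! ### §0 Systems on equal index sets; composites of restrictions -/

/-- A system of modules sends a morphism between EQUAL index sets to a bijection (it is the image of an identity) — the
form in which «`U_j` contains everything» presents itself for shifted systems. [folklore] [cite: GortzWedhorn2023, Def. 21.68 (p. 180)] -/
theorem bijective_map_of_eq {C : Type*} [Preorder C] (F : C ⥤ ModuleCat.{v} A) {a b : C} (f : a ⟶ b) (h : a = b) :
    Function.Bijective (F.map f).hom := by
  subst h
  rw [Subsingleton.elim f (𝟙 a), F.map_id]
  exact Function.bijective_id

variable (N : Finset κ ⥤ ModuleCat.{v} A)

omit [LinearOrder κ] in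
/-- Composite restrictions of a system: `N(t ⊆ u) (N(s ⊆ t) x) = N(s ⊆ u) x` (any proofs of the inclusions).
[folklore] [cite: GortzWedhorn2023, Def. 21.68 (p. 180)] -/
theorem map_map_apply {s t u : Finset κ} (hst : s ⊆ t) (htu : t ⊆ u) (hsu : s ⊆ u) (x : N.obj s) :
    (N.map (homOfLE htu)).hom ((N.map (homOfLE hst)).hom x) = (N.map (homOfLE hsu)).hom x := by
  rw [← ModuleCat.comp_apply, ← N.map_comp]
  rfl

/-- The zero cochain extends by zero to zero. [folklore] [cite: GortzWedhorn2023, Def. 21.68 (p. 180)] -/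
theorem SysCochain.ext0At_zero {n : ℤ} (s t : Finset κ) : (0 : SysCochain N n).ext0At s t = 0 := by
  unfold SysCochain.ext0At
  split_ifs
  · exact map_zero _
  · rfl

/-! ### §1 The cone of an apex vertex with a chosen family of inverses -/

section Inverses

variable (j : κ) (r : ∀ t : Finset κ, N.obj (insert j t) →ₗ[A] N.obj t)
  (hr : ∀ (t : Finset κ) (x : N.obj (insert j t)), (N.map (homOfLE (subset_insert j t))).hom (r t x) = x)
  (hr' : ∀ (t : Finset κ) (x : N.obj t), r t ((N.map (homOfLE (subset_insert j t))).hom x) = x)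

include hr in
/-- Pushing `r_t x` forward past `t ∪ j` recovers `x`: `N(t ⊆ u) (r_t x) = N(t ∪ j ⊆ u) x`. [folklore] -/
private theorem map_apply_inverse {t u : Finset κ} (htu : t ⊆ u) (h : insert j t ⊆ u) (x : N.obj (insert j t)) :
    (N.map (homOfLE htu)).hom (r t x) = (N.map (homOfLE h)).hom x := by
  rw [← map_map_apply N (subset_insert j t) h htu, hr]

include hr' in
/-- The restrictions `N t → N (t ∪ j)` are injective. [folklore] -/
private theorem injective_map_subset_insert (t : Finset κ) :
    Function.Injective (N.map (homOfLE (subset_insert j t))).hom :=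
  Function.LeftInverse.injective (g := r t) (hr' t)

include hr hr' in
/-- **The inverses are natural**: `N(t ⊆ u) ∘ r_t = r_u ∘ N(t ∪ j ⊆ u ∪ j)`. [folklore] -/
private theorem map_inverse_natural {t u : Finset κ} (htu : t ⊆ u) (x : N.obj (insert j t)) :
    (N.map (homOfLE htu)).hom (r t x) = r u ((N.map (homOfLE (insert_subset_insert j htu))).hom x) := by
  apply injective_map_subset_insert N j r hr' u
  rw [hr, map_map_apply N htu (subset_insert j u) ((subset_insert j t).trans (insert_subset_insert j htu)),
    map_apply_inverse N j r hr _ (insert_subset_insert j htu)]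

/-- The faces of an `(n+1)`-simplex are `n`-simplices (`n ≥ 0`). [folklore] -/
private theorem erase_isSimplex {n : ℤ} (hn : 0 ≤ n) (σ : Simplex κ (n + 1)) {a : κ} (ha : a ∈ σ.1) :
    (σ.1.erase a).Nonempty ∧ ((σ.1.erase a).card : ℤ) = n + 1 := by
  have h1 := card_erase_of_mem ha
  have h2 := σ.2.2
  exact ⟨card_pos.mp (by omega), by omega⟩

include hr hr' in
/-- **The homotopy identity `d (h c) + h (d c) = c`** on `Čⁿ⁺¹(N)`, `n ≥ 0`, for the cone
`(h c)_τ = ε(τ ∪ j, j) · r_τ (c_{τ ∪ j})` (`j ∉ τ`), `(h c)_τ = 0` (`j ∈ τ`) of an apex vertex `j`: on `σ ∋ j` only the face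
`σ ∖ j` of `d (h c)` survives and gives `ε(σ, j)² c_σ`; on `σ ∌ j` the term `a = j` of `h (d c)` gives `ε(σ ∪ j, j)² c_σ` and the
other terms cancel against `d (h c)` by `sign_cone_add` and the naturality of the `r_t`.
[cite: StacksProject, Tag 0G6T (proof)] [cite: GortzWedhorn2023, Prop. 21.69 (p. 180)] -/
theorem sysD_cone_add_cone_sysD {n : ℤ} (hn : 0 ≤ n) (c : SysCochain N (n + 1)) (σ : Simplex κ (n + 1)) :
    sysD N n (fun τ : Simplex κ n => if j ∈ τ.1 then (0 : N.obj τ.1) else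
        sign A (insert j τ.1) j • r τ.1 (c.ext0At (insert j τ.1) (insert j τ.1))) σ +
      (if j ∈ σ.1 then (0 : N.obj σ.1) else
        sign A (insert j σ.1) j • r σ.1 ((sysD N (n + 1) c).ext0At (insert j σ.1) (insert j σ.1))) = c σ := by
  -- name the cone in degree `n`
  set h : SysCochain N n := fun τ : Simplex κ n => if j ∈ τ.1 then (0 : N.obj τ.1) else
      sign A (insert j τ.1) j • r τ.1 (c.ext0At (insert j τ.1) (insert j τ.1)) with hh
  have hσ2 : 2 ≤ σ.1.card := by have := σ.2.2; omega
  -- the value of `h` on a face `σ ∖ a` (an `n`-simplex), pushed forward to `σ`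
  have hface : ∀ (a : κ) (ha : a ∈ σ.1), h.ext0At (σ.1.erase a) σ.1 =
      (N.map (homOfLE (erase_subset a σ.1))).hom (h ⟨σ.1.erase a, erase_isSimplex hn σ ha⟩) :=
    fun a ha => SysCochain.ext0At_val h ⟨σ.1.erase a, erase_isSimplex hn σ ha⟩ σ.1 (erase_subset a σ.1)
  have hmem : ∀ (a : κ) (ha : a ∈ σ.1), j ∈ σ.1.erase a → h ⟨σ.1.erase a, erase_isSimplex hn σ ha⟩ = 0 :=
    fun a ha hja => by rw [hh]; exact if_pos hja
  have hnot : ∀ (a : κ) (ha : a ∈ σ.1), j ∉ σ.1.erase a → h ⟨σ.1.erase a, erase_isSimplex hn σ ha⟩ =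
      sign A (insert j (σ.1.erase a)) j •
        r (σ.1.erase a) (c.ext0At (insert j (σ.1.erase a)) (insert j (σ.1.erase a))) :=
    fun a ha hja => by rw [hh]; exact if_neg hja
  rw [sysD_apply]
  by_cases hjσ : j ∈ σ.1
  · -- `j ∈ σ`: the second summand vanishes and only the face `σ ∖ j` contributes
    rw [if_pos hjσ, add_zero, sum_eq_single j]
    · rw [hface j hjσ, hnot j hjσ (notMem_erase j σ.1), map_smul, smul_smul,
        map_apply_inverse N j r hr (erase_subset j σ.1) (insert_erase hjσ).le,
        SysCochain.map_ext0At c _ _ _ subset_rfl (insert_erase hjσ).le, insert_erase hjσ, sign_mul_sign_self,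
        one_smul, SysCochain.ext0At_self]
    · intro a ha haj
      rw [hface a ha, hmem a ha (mem_erase.2 ⟨Ne.symm haj, hjσ⟩), map_zero, smul_zero]
    · intro hj
      exact absurd hjσ hj
  · -- `j ∉ σ`: expand `h (d c)_σ = ε(σ ∪ j, j) · r_σ ((d c)_{σ ∪ j})`; its `a = j` term is `c_σ`
    have hins2 : 2 ≤ (insert j σ.1).card := by rw [card_insert_of_notMem hjσ]; omega
    rw [if_neg hjσ, ext0At_sysD N (n + 1) c _ _ subset_rfl hins2, map_sum, smul_sum, sum_insert hjσ,
      erase_insert hjσ, map_smul, smul_smul, sign_mul_sign_self, one_smul,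
      ← SysCochain.map_ext0At c σ.1 σ.1 (insert j σ.1) subset_rfl (subset_insert j σ.1), hr',
      SysCochain.ext0At_self]
    -- `LHS = Σ_a (…) + (c_σ + Σ_a (…))`; the two sums cancel termwise
    rw [add_comm (c σ), ← add_assoc, ← sum_add_distrib]
    convert zero_add (c σ)
    refine sum_eq_zero fun a ha => ?_
    have haj : a ≠ j := fun e => hjσ (e ▸ ha)
    rw [hface a ha, hnot a ha (fun e => hjσ (mem_of_mem_erase e)), map_smul, map_smul, smul_smul, smul_smul,
      map_inverse_natural N j r hr hr' (erase_subset a σ.1),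
      SysCochain.map_ext0At c _ _ _ subset_rfl (insert_subset_insert j (erase_subset a σ.1)),
      erase_insert_of_ne (Ne.symm haj), ← add_smul, sign_cone_add ha hjσ, zero_smul]

include hr hr' in
/-- **Exactness in positive degrees** (homotopy form): an `(n+1)`-cocycle `c` (`n ≥ 0`) is the coboundary of its cone `h c`.
[cite: StacksProject, Tag 0G6T] [cite: GortzWedhorn2023, Prop. 21.69 (p. 180)] -/
theorem exists_sysD_eq_of_inverses {n : ℤ} (hn : 0 ≤ n) (c : SysCochain N (n + 1)) (hc : sysD N (n + 1) c = 0) :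
    ∃ b : SysCochain N n, sysD N n b = c := by
  refine ⟨fun τ : Simplex κ n => if j ∈ τ.1 then (0 : N.obj τ.1) else
      sign A (insert j τ.1) j • r τ.1 (c.ext0At (insert j τ.1) (insert j τ.1)), funext fun σ => ?_⟩
  have key := sysD_cone_add_cone_sysD N j r hr hr' hn c σ
  rw [hc, SysCochain.ext0At_zero, map_zero, smul_zero, ite_self, add_zero] at key
  exact key

/-- A `0`-cocycle restricts compatibly to every pair, in the rewrite-friendly `ext0At` form: `c_a|_{ab} = c_b|_{ab}`.
[cite: GortzWedhorn2023, Lemma 21.65 (p. 179)] -/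
theorem ext0At_pair_eq_of_sysD_eq_zero (c : SysCochain N 0) (hc : sysD N 0 c = 0) {a b : κ} (hab : a ≠ b) :
    c.ext0At {a} {a, b} = c.ext0At {b} {a, b} := by
  rw [sysD_zero_eq_zero_iff] at hc
  rcases lt_or_gt_of_ne hab with h | h
  · rw [show c.ext0At {a} {a, b} = (N.map (homOfLE (singleton_subset_pair_left a b))).hom (c (vertex a)) from
        SysCochain.ext0At_val c (vertex a) _ (singleton_subset_pair_left a b),
      show c.ext0At {b} {a, b} = (N.map (homOfLE (singleton_subset_pair_right a b))).hom (c (vertex b)) from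
        SysCochain.ext0At_val c (vertex b) _ (singleton_subset_pair_right a b)]
    exact hc a b h
  · rw [pair_comm a b,
      show c.ext0At {a} {b, a} = (N.map (homOfLE (singleton_subset_pair_right b a))).hom (c (vertex a)) from
        SysCochain.ext0At_val c (vertex a) _ (singleton_subset_pair_right b a),
      show c.ext0At {b} {b, a} = (N.map (homOfLE (singleton_subset_pair_left b a))).hom (c (vertex b)) from
        SysCochain.ext0At_val c (vertex b) _ (singleton_subset_pair_left b a)]
    exact (hc b a h).symm

include hr hr' in
/-- **Every `0`-cocycle is an augmented value**: `c = ε (r_∅ (c_j))`. [cite: StacksProject, Tag 0G6T]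
[cite: GortzWedhorn2023, Lemma 21.65 (p. 179)] -/
theorem exists_sysAugment_eq_of_inverses (c : SysCochain N 0) (hc : sysD N 0 c = 0) :
    ∃ g : N.obj ∅, sysAugment N g = c := by
  classical
  refine ⟨r ∅ (c.ext0At {j} (insert j ∅)), funext fun τ => ?_⟩
  obtain ⟨i, rfl⟩ := exists_eq_vertex τ
  rw [sysAugment_apply]
  by_cases hij : i = j
  · subst hij
    rw [map_apply_inverse N i r hr (empty_subset _) (by simp),
      SysCochain.map_ext0At c _ _ _ (by simp) (by simp)]
    exact SysCochain.ext0At_self c (vertex i)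
  · rw [map_inverse_natural N j r hr hr' (empty_subset _), SysCochain.map_ext0At c _ _ _ (by simp) (by simp)]
    change r {i} (c.ext0At {j} {j, i}) = c (vertex i)
    rw [ext0At_pair_eq_of_sysD_eq_zero N c hc (Ne.symm hij),
      ← SysCochain.map_ext0At c {i} {i} (insert j {i}) subset_rfl (subset_insert j {i}), hr']
    exact SysCochain.ext0At_self c (vertex i)

include hr' in
/-- **The augmentation is injective** (already `N ∅ → N {j}` is). [cite: GortzWedhorn2023, Lemma 21.65 (p. 179)] -/
theorem sysAugment_injective_of_inverses : Function.Injective (sysAugment N) := by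
  refine sysAugment_injective_of N j ?_
  have hfac : (N.map (homOfLE (empty_subset ({j} : Finset κ)))).hom =
      (N.map (homOfLE (by simp : insert j (∅ : Finset κ) ⊆ {j}))).hom ∘
        (N.map (homOfLE (subset_insert j (∅ : Finset κ)))).hom := by
    funext x
    exact (map_map_apply N (subset_insert j ∅) (by simp) (empty_subset _) x).symm
  rw [hfac]
  exact (bijective_map_of_eq N _ (by simp)).1.comp (injective_map_subset_insert N j r hr' ∅)

end Inverses

/-! ### §2 From an apex vertex (bijective restrictions `N t → N (t ∪ j)`) -/

section Apex

variable {N} {j : κ} (hj : ∀ t : Finset κ, Function.Bijective (N.map (homOfLE (subset_insert j t))).hom)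

include hj in
/-- The inverse family of an apex vertex. [folklore] -/
private theorem exists_inverses_of_apex :
    ∃ r : ∀ t : Finset κ, N.obj (insert j t) →ₗ[A] N.obj t,
      (∀ (t : Finset κ) (x : N.obj (insert j t)), (N.map (homOfLE (subset_insert j t))).hom (r t x) = x) ∧
      (∀ (t : Finset κ) (x : N.obj t), r t ((N.map (homOfLE (subset_insert j t))).hom x) = x) :=
  ⟨fun t => ((LinearEquiv.ofBijective _ (hj t)).symm : N.obj (insert j t) →ₗ[A] N.obj t),
    fun t x => (LinearEquiv.ofBijective _ (hj t)).apply_symm_apply x,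
    fun t x => (LinearEquiv.ofBijective _ (hj t)).symm_apply_apply x⟩

include hj in
/-- **Apex vertex ⇒ `ε : N ∅ → Č⁰(N)` is injective.** [cite: StacksProject, Tag 0G6T] [cite: GortzWedhorn2023, Lemma 21.65 (p. 179)] -/
theorem sysAugment_injective_of_apex : Function.Injective (sysAugment N) := by
  obtain ⟨r, -, hr'⟩ := exists_inverses_of_apex hj
  exact sysAugment_injective_of_inverses N j r hr'

include hj in
/-- **Apex vertex ⇒ every `0`-cocycle of `Č•(N)` is an augmented value.** [cite: StacksProject, Tag 0G6T]
[cite: GortzWedhorn2023, Lemma 21.65 (p. 179)] -/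
theorem exists_sysAugment_eq_of_apex (c : SysCochain N 0) (hc : sysD N 0 c = 0) :
    ∃ g : N.obj ∅, sysAugment N g = c := by
  obtain ⟨r, hr, hr'⟩ := exists_inverses_of_apex hj
  exact exists_sysAugment_eq_of_inverses N j r hr hr' c hc

include hj in
/-- **Apex vertex ⇒ `Č•(N)` is exact in positive degrees** (cochain form, degree `n + 1` with `n ≥ 0`).
[cite: StacksProject, Tag 0G6T] [cite: GortzWedhorn2023, Prop. 21.69 (p. 180)] -/
theorem exists_sysD_eq_of_apex {n : ℤ} (hn : 0 ≤ n) (c : SysCochain N (n + 1)) (hc : sysD N (n + 1) c = 0) :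
    ∃ b : SysCochain N n, sysD N n b = c := by
  obtain ⟨r, hr, hr'⟩ := exists_inverses_of_apex hj
  exact exists_sysD_eq_of_inverses N j r hr hr' hn c hc

include hj in
/-- **Apex vertex ⇒ `Č•(N)` is exact in every degree `n ≥ 1`**, in the binder shape of
`OrderedCechPairSystemComparison.homologyIsoEmptyComplexOfSystems` (differentials `(sysComplex N).d`).
[cite: StacksProject, Tag 0G6T] [cite: GortzWedhorn2023, Prop. 21.69 (p. 180)] -/
theorem exists_d_eq_of_apex (n : ℤ) (hn : 1 ≤ n) (x : SysCochain N n)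
    (hx : ((sysComplex N).d n (n + 1)).hom x = 0) :
    ∃ y : SysCochain N (n - 1), ((sysComplex N).d (n - 1) n).hom y = x := by
  obtain ⟨m, rfl⟩ : ∃ m, m + 1 = n := ⟨n - 1, by omega⟩
  have e : m + 1 - 1 = m := by omega
  rw [e, sysComplex_d]
  rw [sysComplex_d] at hx
  exact exists_sysD_eq_of_apex hj (by omega) x hx

end Apex

end OrderedCech

end Literature.Algebra.Homology

end
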